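import Literature.NumberTheory.QuadraticFields.LenstraPomeranceCoprimePairs
import Literature.Topology.FourManifolds.LatticeFormsWallGenerators
import HarnessLib

/-!
# Primitive vectors of the hyperbolic plane up to `O(U)`: Markman's `𝒫_n` and `|𝒫_n| = 2^{ρ(n−1)−1}`
# (Markman, Int. J. Math. 21 (2010), §4.1, the paragraph before Lemma 4.3)

Trunk T-4MAN vocabulary (`hyperbolicForm` = the hyperbolic plane `U` on `ℤ²`, `U(v, w) = v₀ w₁ + v₁ w₀`;
`LatticeFormsWallGenerators`: `hyperbolicSwap = σ`, `hyperbolicForm_isometryEquiv_eq`: `O(U) = {±1, ±σ}`). Written for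
lane `lit-hodgefound` (Track 2 foundations; prover seat `lit-hodgefound-p18`, gen 48, row g48-#4), companion of
`AlgebraicGeometry/Hyperkaehler/K3HilbertMukaiLatticeEmbeddingRepresentatives` (g48-#3: Lemma 4.3 (1), the embeddings
`ι_{r,s}`). THEOREMS ONLY — no definition, no named fact, no instance, no notation.

## Source, verbatim (E. Markman, *Integral constraints on the monodromy group of the hyperkähler resolution of a
## symmetric product of a K3 surface*, Int. J. Math. 21 (2010), §4.1; held text `paper:arxiv-math_0601304` p. 19)

"Let `𝒫_n` be the subset of `ℤ ⊕ ℤ` given by `𝒫_n := {(r,s) : −s ≥ r > 0, rs = 1−n, and gcd(r,s) = 1}`. The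
cardinality of `𝒫_n` is clearly `2^{ρ(n−1)−1}`. Let `U` be the rank `2` hyperbolic lattice given by the pairing
`((r₁,s₁),(r₂,s₂)) = −r₁s₂ − r₂s₁`. Then `O(U)` is isomorphic to `ℤ/2ℤ × ℤ/2ℤ`. The set `𝒫_n` consists of one
representative from each `O(U)`-orbit of primitive elements of `U` of square-length `2n−2`." (`ρ(r)` = "the number
of prime divisors of `r`", p. 31 of the survey.)

## Rendering

The tree's `U = hyperbolicForm` has the pairing `+v₀ w₁ + v₁ w₀`, so Markman's `(r, s)` (`rs = 1 − n`, `−s ≥ r > 0`) is our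
`(r, s')` with `s' = −s`, `r s' = n − 1 =: t`, `0 < r ≤ s'`; "primitive" for `v ∈ U` is rendered both as SATURATION of
`ℤv` (`k w ∈ ℤv`, `k ≠ 0` ⟹ `w ∈ ℤv`, the tree's standing form) and as `gcd(v₀, v₁) = 1`, proved equivalent (§1); the
orbit set is the quotient of `{v : gcd(v₀,v₁) = 1, (v,v) = 2t}` by `v ∼ w :⟺ ∃ φ ∈ O(U), φ v = w`.

## Contents (all proved)

* (arithmetic, REUSED from the tree: `Literature/NumberTheory/QuadraticFields/LenstraPomeranceCoprimePairs.lean`,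
  `card_filter_coprime_le_divisorsAntidiagonal` — the coprime splittings `r s = t`, `r ≤ s`, number `2^{ρ(t)−1}` for
  `t > 1`, and `…_one` for `t = 1`.)
* §1 primitive vectors of `U`: `ℤv` is saturated iff `gcd(v₀, v₁) = 1`
  (`forall_smul_mem_span_singleton_iff_gcd_eq_one`); `(v, v) = 2 v₀ v₁`; the `O(U)`-orbit of `v` is
  `{v, −v, σv, −σv}` (`exists_hyperbolicForm_isometryEquiv_apply_eq_iff`); NORMAL FORM: a primitive `v` with
  `(v,v) = 2t > 0` is `O(U)`-equivalent to `(r, s)` with `0 < r ≤ s`, `r s = t`, `gcd(r,s) = 1`, namely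
  `(min(|v₀|,|v₁|), max(|v₀|,|v₁|))`, and two normal forms in one orbit coincide ("one representative from each
  `O(U)`-orbit").
* §2 **the number of `O(U)`-orbits of primitive vectors of square-length `2t` is `2^{ρ(t)−1}`** (`t ≥ 1`;
  `natCard_quot_primitive_hyperbolicForm_eq`) — "The cardinality of `𝒫_n` is clearly `2^{ρ(n−1)−1}`"; together with
  g48-#3 §4 this is Markman's second computation of `|O(Λ_n, Λ̃)/O(Λ̃)|` (g47-#10
  `k3HilbertLattice_natCard_quot_embedding_mukaiLattice`).
-/

namespace Literature.Topology.FourManifolds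

open Finset

/-! ### §1 Primitive vectors of `U` and their `O(U)`-orbits -/

section Primitive

open LinearMap.BilinForm

/-- **`ℤv ⊂ ℤ²` is saturated iff `gcd(v₀, v₁) = 1`** (`v ≠ 0`): "primitive elements of `U`". [cite: Markman2010Constraints, §4.1 ("primitive elements of U")] -/
theorem forall_smul_mem_span_singleton_iff_gcd_eq_one {v : Fin 2 → ℤ} (hv : v ≠ 0) :
    (∀ (k : ℤ) (w : Fin 2 → ℤ), k ≠ 0 → k • w ∈ ℤ ∙ v → w ∈ ℤ ∙ v) ↔ Int.gcd (v 0) (v 1) = 1 := by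
  constructor
  · intro h
    set g := Int.gcd (v 0) (v 1) with hg
    have hg0 : g ≠ 0 := fun h0 ↦ hv (by
      obtain ⟨h1, h2⟩ := Int.gcd_eq_zero_iff.1 h0
      funext i; fin_cases i <;> assumption)
    obtain ⟨a, ha⟩ : (g : ℤ) ∣ v 0 := Int.gcd_dvd_left _ _
    obtain ⟨b, hb⟩ : (g : ℤ) ∣ v 1 := Int.gcd_dvd_right _ _
    have hw : (g : ℤ) • ![a, b] = v := by
      funext i
      fin_cases i
      · simp [ha]
      · simp [hb]
    have hmem := h g ![a, b] (by exact_mod_cast hg0) (by rw [hw]; exact Submodule.mem_span_singleton_self v)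
    obtain ⟨c, hc⟩ := Submodule.mem_span_singleton.1 hmem
    -- `c v = (a, b)` and `g (a, b) = v`: `c g v = v`, so `c g = 1`
    have hcg : ((g : ℤ) * c) • v = v := by rw [mul_smul, hc, hw]
    have hcg1 : (g : ℤ) * c = 1 := by
      by_contra hne
      apply hv
      have h1 : ((g : ℤ) * c - 1) • v = 0 := by rw [sub_smul, hcg, one_smul, sub_self]
      rcases smul_eq_zero.1 h1 with h2 | h2
      · exact absurd (sub_eq_zero.1 h2) hne
      · exact h2
    have h3 : (g : ℤ) ∣ 1 := ⟨c, hcg1.symm⟩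
    exact Nat.dvd_one.1 (by exact_mod_cast h3)
  · intro h k w hk hkw
    obtain ⟨c, hc⟩ := Submodule.mem_span_singleton.1 hkw
    -- Bezout: `a v₀ + b v₁ = 1`; `k w = c v` gives `k ∣ c`
    obtain ⟨a, b, hab⟩ := Int.isCoprime_iff_gcd_eq_one.2 h
    have h0 : c * v 0 = k * w 0 := by simpa using congrFun hc 0
    have h1 : c * v 1 = k * w 1 := by simpa using congrFun hc 1
    have hdvd : k ∣ c := ⟨a * w 0 + b * w 1, by linear_combination -c * hab + a * h0 + b * h1⟩
    obtain ⟨c', rfl⟩ := hdvd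
    refine Submodule.mem_span_singleton.2 ⟨c', ?_⟩
    have : k • (c' • v) = k • w := by rw [← mul_smul, hc]
    exact smul_right_injective _ hk this

/-- The `O(U)`-ORBIT of `v`: `w = φ v` for some `φ ∈ O(U) = {±1, ±σ}` iff `w ∈ {v, −v, σv, −σv}`, `σv = (v₁, v₀)`
("`O(U)` is isomorphic to `ℤ/2ℤ × ℤ/2ℤ`"). [cite: Markman2010Constraints, §4.1] [cite: Kirby1989, Ch. X, proof of Thm. 2] -/
theorem exists_hyperbolicForm_isometryEquiv_apply_eq_iff (v w : Fin 2 → ℤ) :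
    (∃ φ : hyperbolicForm.IsometryEquiv hyperbolicForm, φ v = w) ↔
      w = v ∨ w = -v ∨ w = ![v 1, v 0] ∨ w = -![v 1, v 0] := by
  constructor
  · rintro ⟨φ, rfl⟩
    rcases hyperbolicForm_isometryEquiv_eq φ with h | h | h | h <;> rw [h]
    · exact Or.inl rfl
    · exact Or.inr (Or.inl (LinearMap.BilinForm.IsometryEquiv.neg_apply _ _))
    · exact Or.inr (Or.inr (Or.inl (hyperbolicSwap_apply v)))
    · refine Or.inr (Or.inr (Or.inr ?_))
      rw [LinearMap.BilinForm.IsometryEquiv.trans_apply, hyperbolicSwap_apply, LinearMap.BilinForm.IsometryEquiv.neg_apply]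
  · rintro (rfl | rfl | rfl | rfl)
    · exact ⟨LinearMap.BilinForm.IsometryEquiv.refl _, rfl⟩
    · exact ⟨LinearMap.BilinForm.IsometryEquiv.neg _, rfl⟩
    · exact ⟨hyperbolicSwap, hyperbolicSwap_apply v⟩
    · exact ⟨hyperbolicSwap.trans (LinearMap.BilinForm.IsometryEquiv.neg _), by
        rw [LinearMap.BilinForm.IsometryEquiv.trans_apply, hyperbolicSwap_apply, LinearMap.BilinForm.IsometryEquiv.neg_apply]⟩

/-- `gcd` is an `O(U)`-invariant: vectors in one orbit have the same `gcd(v₀, v₁)` (so primitivity is `O(U)`-invariant).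
[cite: Markman2010Constraints, §4.1 ("O(U)-orbit of primitive elements")] -/
theorem gcd_eq_of_hyperbolicForm_isometryEquiv_apply_eq {v w : Fin 2 → ℤ}
    (φ : hyperbolicForm.IsometryEquiv hyperbolicForm) (h : φ v = w) : Int.gcd (w 0) (w 1) = Int.gcd (v 0) (v 1) := by
  rcases (exists_hyperbolicForm_isometryEquiv_apply_eq_iff v w).1 ⟨φ, h⟩ with rfl | rfl | rfl | rfl
  · rfl
  · simp [Int.gcd_eq_natAbs]
  · simp [Int.gcd_eq_natAbs, Nat.gcd_comm]
  · simp [Int.gcd_eq_natAbs, Nat.gcd_comm]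

/-- **Normal form: every primitive `v ∈ U` with `(v, v) = 2t > 0` is `O(U)`-equivalent to `(r, s)` with
`0 < r ≤ s`, `r s = t`, `gcd(r, s) = 1`** — namely `r = min(|v₀|, |v₁|)`, `s = max(|v₀|, |v₁|)`
("one representative from each `O(U)`-orbit of primitive elements of `U` of square-length `2n−2`").
[cite: Markman2010Constraints, §4.1] -/
theorem exists_hyperbolicForm_isometryEquiv_apply_eq_normalForm {v : Fin 2 → ℤ} {t : ℕ} (ht : 0 < t)
    (hv : hyperbolicForm v v = 2 * t) (hprim : Int.gcd (v 0) (v 1) = 1) :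
    ∃ (φ : hyperbolicForm.IsometryEquiv hyperbolicForm) (r s : ℕ), 0 < r ∧ r ≤ s ∧ r * s = t ∧ Nat.Coprime r s ∧
      φ v = ![(r : ℤ), (s : ℤ)] := by
  rw [hyperbolicForm_apply_self] at hv
  have hab : v 0 * v 1 = t := by linarith
  have ha0 : v 0 ≠ 0 := fun h ↦ by rw [h, zero_mul] at hab; omega
  have hb0 : v 1 ≠ 0 := fun h ↦ by rw [h, mul_zero] at hab; omega
  have hcop : Nat.Coprime (v 0).natAbs (v 1).natAbs := by rw [Nat.Coprime, ← Int.gcd_eq_natAbs, hprim]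
  have hprod : (v 0).natAbs * (v 1).natAbs = t := by rw [← Int.natAbs_mul, hab, Int.natAbs_natCast]
  -- first make both coordinates positive (they have the same sign): `±1`
  obtain ⟨φ₁, hφ₁⟩ : ∃ φ₁ : hyperbolicForm.IsometryEquiv hyperbolicForm,
      φ₁ v = ![((v 0).natAbs : ℤ), ((v 1).natAbs : ℤ)] := by
    rcases lt_or_gt_of_ne ha0 with ha | ha
    · have hb : v 1 < 0 := by
        by_contra hb
        have : v 0 * v 1 ≤ 0 := mul_nonpos_of_nonpos_of_nonneg ha.le (not_lt.1 hb)
        omega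
      refine ⟨LinearMap.BilinForm.IsometryEquiv.neg _, ?_⟩
      rw [LinearMap.BilinForm.IsometryEquiv.neg_apply, Int.ofNat_natAbs_of_nonpos ha.le,
        Int.ofNat_natAbs_of_nonpos hb.le]
      funext i
      fin_cases i <;> simp
    · have hb : 0 < v 1 := by
        by_contra hb
        have : v 0 * v 1 ≤ 0 := mul_nonpos_of_nonneg_of_nonpos ha.le (not_lt.1 hb)
        omega
      refine ⟨LinearMap.BilinForm.IsometryEquiv.refl _, ?_⟩
      rw [Int.natAbs_of_nonneg ha.le, Int.natAbs_of_nonneg hb.le]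
      change v = _
      funext i
      fin_cases i <;> simp
  -- then order them: `σ` if necessary
  rcases le_or_gt (v 0).natAbs (v 1).natAbs with hle | hlt
  · exact ⟨φ₁, (v 0).natAbs, (v 1).natAbs, Int.natAbs_pos.2 ha0, hle, hprod, hcop, hφ₁⟩
  · refine ⟨φ₁.trans hyperbolicSwap, (v 1).natAbs, (v 0).natAbs, Int.natAbs_pos.2 hb0, hlt.le,
      (mul_comm _ _).trans hprod, hcop.symm, ?_⟩
    rw [LinearMap.BilinForm.IsometryEquiv.trans_apply, hφ₁, hyperbolicSwap_apply]
    simp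

/-- **Uniqueness of the normal form**: if `(r, s)` and `(r', s')` with `0 < r ≤ s`, `0 < r' ≤ s'` are `O(U)`-equivalent
then `(r, s) = (r', s')` ("one representative from each `O(U)`-orbit"). [cite: Markman2010Constraints, §4.1] -/
theorem normalForm_unique {r s r' s' : ℕ} (hr : 0 < r) (hrs : r ≤ s) (hr's' : r' ≤ s')
    (φ : hyperbolicForm.IsometryEquiv hyperbolicForm) (h : φ ![(r : ℤ), (s : ℤ)] = ![(r' : ℤ), (s' : ℤ)]) :
    r = r' ∧ s = s' := by
  rcases (exists_hyperbolicForm_isometryEquiv_apply_eq_iff _ _).1 ⟨φ, h⟩ with h | h | h | h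
  · have h0 := congrFun h 0
    have h1 := congrFun h 1
    simp only [Matrix.cons_val_zero, Matrix.cons_val_one] at h0 h1
    constructor <;> omega
  · have h0 := congrFun h 0
    simp only [Pi.neg_apply, Matrix.cons_val_zero] at h0
    omega
  · have h0 := congrFun h 0
    have h1 := congrFun h 1
    simp only [Matrix.cons_val_zero, Matrix.cons_val_one] at h0 h1
    constructor <;> omega
  · have h0 := congrFun h 0
    simp only [Pi.neg_apply, Matrix.cons_val_zero, Matrix.cons_val_one] at h0
    omega

/-- The normal-form vector `(r, s)` is primitive of square-length `2 r s`. [cite: Markman2010Constraints, §4.1] -/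
theorem gcd_normalForm_eq_one_and_hyperbolicForm_apply {r s : ℕ} (hcop : Nat.Coprime r s) :
    Int.gcd (![(r : ℤ), (s : ℤ)] 0) (![(r : ℤ), (s : ℤ)] 1) = 1 ∧
      hyperbolicForm ![(r : ℤ), (s : ℤ)] ![(r : ℤ), (s : ℤ)] = 2 * (r * s : ℕ) := by
  refine ⟨?_, ?_⟩
  · simp only [Matrix.cons_val_zero, Matrix.cons_val_one]
    rw [Int.gcd_natCast_natCast]
    exact hcop
  · rw [hyperbolicForm_apply_self]
    simp

end Primitive

/-! ### §2 The number of `O(U)`-orbits of primitive vectors of square-length `2t` is `2^{ρ(t)−1}` -/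

section Count

open LinearMap.BilinForm

/-- The normal form `(min(|v₀|,|v₁|), max(|v₀|,|v₁|))` of a primitive `v` with `(v,v) = 2t > 0` lies in the set of
coprime splittings `r s = t`, `r ≤ s`. [folklore] -/
private theorem normalForm_mem {v : Fin 2 → ℤ} {t : ℕ} (ht : 0 < t) (hv : hyperbolicForm v v = 2 * t)
    (hprim : Int.gcd (v 0) (v 1) = 1) :
    (min (v 0).natAbs (v 1).natAbs, max (v 0).natAbs (v 1).natAbs) ∈
      {x ∈ t.divisorsAntidiagonal | Nat.Coprime x.1 x.2 ∧ x.1 ≤ x.2} := by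
  rw [hyperbolicForm_apply_self] at hv
  have hab : v 0 * v 1 = t := by linarith
  have hcop : Nat.Coprime (v 0).natAbs (v 1).natAbs := by rw [Nat.Coprime, ← Int.gcd_eq_natAbs, hprim]
  have hprod : (v 0).natAbs * (v 1).natAbs = t := by rw [← Int.natAbs_mul, hab, Int.natAbs_natCast]
  rw [Finset.mem_filter, Nat.mem_divisorsAntidiagonal]
  refine ⟨⟨?_, ht.ne'⟩, ?_, min_le_max⟩
  · rcases le_total (v 0).natAbs (v 1).natAbs with h | h
    · rw [min_eq_left h, max_eq_right h, hprod]
    · rw [min_eq_right h, max_eq_left h, mul_comm, hprod]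
  · rcases le_total (v 0).natAbs (v 1).natAbs with h | h
    · rw [min_eq_left h, max_eq_right h]; exact hcop
    · rw [min_eq_right h, max_eq_left h]; exact hcop.symm

/-- Vectors in one `O(U)`-orbit have the same normal form. [folklore] -/
private theorem normalForm_eq_of_isometryEquiv {v w : Fin 2 → ℤ} (φ : hyperbolicForm.IsometryEquiv hyperbolicForm)
    (h : φ v = w) :
    (min (w 0).natAbs (w 1).natAbs, max (w 0).natAbs (w 1).natAbs) =
      (min (v 0).natAbs (v 1).natAbs, max (v 0).natAbs (v 1).natAbs) := by
  rcases (exists_hyperbolicForm_isometryEquiv_apply_eq_iff v w).1 ⟨φ, h⟩ with rfl | rfl | rfl | rfl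
  · rfl
  · simp
  · simp [min_comm, max_comm]
  · simp [min_comm, max_comm]

/-- A primitive `v` with `(v, v) = 2t > 0` is `O(U)`-equivalent to its normal-form vector. [folklore] -/
private theorem exists_isometryEquiv_normalForm_apply_eq {v : Fin 2 → ℤ} {t : ℕ} (ht : 0 < t)
    (hv : hyperbolicForm v v = 2 * t) (hprim : Int.gcd (v 0) (v 1) = 1) :
    ∃ φ : hyperbolicForm.IsometryEquiv hyperbolicForm,
      φ ![((min (v 0).natAbs (v 1).natAbs : ℕ) : ℤ), ((max (v 0).natAbs (v 1).natAbs : ℕ) : ℤ)] = v := by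
  obtain ⟨φ, r, s, -, hrs, -, -, hφ⟩ := exists_hyperbolicForm_isometryEquiv_apply_eq_normalForm ht hv hprim
  have hnf := normalForm_eq_of_isometryEquiv φ hφ
  simp only [Matrix.cons_val_zero, Matrix.cons_val_one, Int.natAbs_natCast, min_eq_left hrs, max_eq_right hrs] at hnf
  have h1 := congrArg Prod.fst hnf
  have h2 := congrArg Prod.snd hnf
  simp only at h1 h2
  refine ⟨φ.symm, ?_⟩
  rw [← h1, ← h2, ← hφ]
  exact φ.toLinearEquiv.symm_apply_apply v

/-- **"The set `𝒫_n` consists of one representative from each `O(U)`-orbit of primitive elements of `U` of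
square-length `2n−2`" and "The cardinality of `𝒫_n` is clearly `2^{ρ(n−1)−1}`"**: for `t ≥ 1`, the `O(U)`-orbits of
the primitive vectors `v ∈ U` (`gcd(v₀, v₁) = 1`) with `(v, v) = 2t` number `2^{ρ(t)−1}`, `ρ(t)` the number of prime
divisors of `t`. [cite: Markman2010Constraints, §4.1] -/
theorem natCard_quot_primitive_hyperbolicForm_eq {t : ℕ} (ht : 0 < t) :
    Nat.card (Quot fun v w : {v : Fin 2 → ℤ // Int.gcd (v 0) (v 1) = 1 ∧ hyperbolicForm v v = 2 * t} ↦
        ∃ φ : hyperbolicForm.IsometryEquiv hyperbolicForm, φ v.1 = w.1) =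
      2 ^ (t.primeFactors.card - 1) := by
  set A := {x ∈ t.divisorsAntidiagonal | Nat.Coprime x.1 x.2 ∧ x.1 ≤ x.2} with hA
  -- the normal form descends to the orbit set and is a bijection onto `A`
  let F : (Quot fun v w : {v : Fin 2 → ℤ // Int.gcd (v 0) (v 1) = 1 ∧ hyperbolicForm v v = 2 * t} ↦
      ∃ φ : hyperbolicForm.IsometryEquiv hyperbolicForm, φ v.1 = w.1) → A :=
    Quot.lift (fun v ↦ ⟨(min (v.1 0).natAbs (v.1 1).natAbs, max (v.1 0).natAbs (v.1 1).natAbs),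
      normalForm_mem ht v.2.2 v.2.1⟩) (by
        rintro v w ⟨φ, hφ⟩
        exact Subtype.ext (normalForm_eq_of_isometryEquiv φ hφ).symm)
  let G : A → (Quot fun v w : {v : Fin 2 → ℤ // Int.gcd (v 0) (v 1) = 1 ∧ hyperbolicForm v v = 2 * t} ↦
      ∃ φ : hyperbolicForm.IsometryEquiv hyperbolicForm, φ v.1 = w.1) := fun x ↦
    Quot.mk _ ⟨![(x.1.1 : ℤ), (x.1.2 : ℤ)], by
      have hx : (x.1 : ℕ × ℕ) ∈ {x ∈ t.divisorsAntidiagonal | Nat.Coprime x.1 x.2 ∧ x.1 ≤ x.2} := x.2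
      rw [Finset.mem_filter, Nat.mem_divisorsAntidiagonal] at hx
      obtain ⟨h1, h2⟩ := gcd_normalForm_eq_one_and_hyperbolicForm_apply hx.2.1
      rw [hx.1.1] at h2
      exact ⟨h1, h2⟩⟩
  have hFG : ∀ x, F (G x) = x := fun x ↦ by
    obtain ⟨⟨r, s⟩, hx⟩ := x
    have hx' : (r, s) ∈ {x ∈ t.divisorsAntidiagonal | Nat.Coprime x.1 x.2 ∧ x.1 ≤ x.2} := hx
    rw [Finset.mem_filter] at hx'
    apply Subtype.ext
    change (min (![(r : ℤ), (s : ℤ)] 0).natAbs (![(r : ℤ), (s : ℤ)] 1).natAbs,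
      max (![(r : ℤ), (s : ℤ)] 0).natAbs (![(r : ℤ), (s : ℤ)] 1).natAbs) = (r, s)
    simp only [Matrix.cons_val_zero, Matrix.cons_val_one, Int.natAbs_natCast, min_eq_left hx'.2.2,
      max_eq_right hx'.2.2]
  have hGF : ∀ q, G (F q) = q := by
    rintro ⟨v⟩
    change Quot.mk _ _ = Quot.mk _ _
    exact Quot.sound (exists_isometryEquiv_normalForm_apply_eq ht v.2.2 v.2.1)
  let E : (Quot fun v w : {v : Fin 2 → ℤ // Int.gcd (v 0) (v 1) = 1 ∧ hyperbolicForm v v = 2 * t} ↦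
      ∃ φ : hyperbolicForm.IsometryEquiv hyperbolicForm, φ v.1 = w.1) ≃ A :=
    { toFun := F, invFun := G, left_inv := hGF, right_inv := hFG }
  rw [Nat.card_congr E, Nat.card_eq_fintype_card, Fintype.card_coe, hA]
  rcases Nat.lt_or_ge 1 t with ht1 | ht1
  · exact Literature.NumberTheory.QuadraticFields.BinaryQuadraticForm.card_filter_coprime_le_divisorsAntidiagonal ht1
  · obtain rfl : t = 1 := by omega
    rw [Literature.NumberTheory.QuadraticFields.BinaryQuadraticForm.card_filter_coprime_le_divisorsAntidiagonal_one,
      Nat.primeFactors_one, Finset.card_empty]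
    norm_num

end Count

end Literature.Topology.FourManifolds
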